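import Mathlib.LinearAlgebra.Matrix.ToLin
import Literature.Computability.AlgebraicComplexity.LRWeightCount
import Literature.Computability.AlgebraicComplexity.GrenetPencilCanonicalSubspaces
import HarnessLib

/-!
# Level forms of a left-equivariant Grenet-shaped pencil are proportional

Topic `Literature/Computability/AlgebraicComplexity`.  Continues
`GrenetPencilCanonicalSubspaces.lean` (a Grenet-shaped pencil — rows labelled by `row i ≠ univ`,
columns by `col j ≠ ∅`, `Λ = ε · [row i = col j]`, `A_{pq}` supported on the arcs
`row i → row i ∪ {p}` with coefficients `b (row i) p q` — has canonical subspaces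
`𝒫_{S'} = 𝒰_row(S'ᶜ)` as soon as they are canonically new, and then an exact lift `(B, C)` of a
row permutation `σ` permutes the up-set coordinate subspaces: `B 𝒰_row(S) = 𝒰_row(σ S)`,
`C 𝒰_col(S) = 𝒰_col(σ S)`).  Here this is turned into the SYMMETRY HALF of the equality case of
Landsberg–Ressayre's Thm. 2.8 (LR17 §6 and the remark after Thm. 2.8: Grenet's representation is
the equivariant representation of size `2^N - 1`):

* `apply_single_ne_zero_of_map_eq` — TRIANGULARITY: an automorphism `g` of `K^ι` permuting the
  up-set subspaces along `σ` has a non-zero "diagonal" coefficient `(g e_i)_{i'}`, `lab i' = σ (lab i)`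
  (`g` maps the hyperplane `∑_{x ∉ lab i} 𝒰(lab i ∪ {x})` of `𝒰(lab i)` onto that of `𝒰(σ lab i)`);
* `orbit_ratio` — reading `B A_{kq} = A_{σ k, q} C` on `e_{col (S ∪ {k})}` at the row `σ S`:
  `b (σ S) (σ k) · = r · b S k ·` with `r ≠ 0` independent of the column index `q`;
* `exists_factorisation_of_orbit` — `𝔖_N` is transitive on the arcs `(S, k)`, `k ∉ S`, of a given
  level `|S|`, so orbit-proportional arc forms factor as `b S k q = ρ S k · α |S| q`;
* `TorusData.not_canon_le_iSup_ssubsets` — canonical newness of every `𝒫_{S'}`, `S' ≠ ∅`, for a torus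
  datum with `dim ker Λ = 1`, an injective member and all permutation lifts (`LRWeightCount.lean`);
* `exists_level_factorisation` — **conclusion for matrices**: if the pencil `(Λm, Am)` of
  Grenet shape carries such a torus datum, its arc coefficients factor through the levels.

## References

* J. M. Landsberg, N. Ressayre, *Permanent v. determinant: an exponential lower bound assuming
  symmetry and a potential path towards Valiant's conjecture*, Differential Geom. Appl. 55 (2017)
  146–166, arXiv:1508.05788, Thm. 2.8 and §6 (key `LandsbergRessayre2017`).
* B. Grenet, *An upper bound for the permanent versus determinant problem* (2011), Thm. 1
  (key `Grenet2011`).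
-/

noncomputable section

namespace Literature.Computability.AlgebraicComplexity

namespace LRPencil

open Submodule Finset

section Shape

variable {K : Type*} [Field K] {N : ℕ} {ι : Type*}
  {row col : ι → Finset (Fin N)} {b : Finset (Fin N) → Fin N → Fin N → K}
  {Λ : Module.End K (ι → K)} {A : Fin N → Fin N → Module.End K (ι → K)}
  {Ur Uc : Finset (Fin N) → Submodule K (ι → K)}
  (hrow_inj : Function.Injective row) (hrow_ex : ∀ S, S ≠ univ → ∃ i, row i = S)
  (hcol_inj : Function.Injective col) (hcol_ex : ∀ T, T ≠ ∅ → ∃ j, col j = T)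
  (hAv : ∀ (p q : Fin N) (w : ι → K) (i j : ι), p ∉ row i → col j = insert p (row i) →
    A p q w i = b (row i) p q * w j)
  (hA0 : ∀ (p q : Fin N) (w : ι → K) (i : ι), p ∈ row i → A p q w i = 0)
  (hUr : ∀ (S : Finset (Fin N)) (v : ι → K), v ∈ Ur S ↔ ∀ i, ¬ S ⊆ row i → v i = 0)
  (hUc : ∀ (S : Finset (Fin N)) (w : ι → K), w ∈ Uc S ↔ ∀ j, ¬ S ⊆ col j → w j = 0)

variable [DecidableEq ι]

/-! ### Arcs -/

include hrow_inj hcol_inj hcol_ex hAv hA0 in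
/-- `A_{pq} e_{col (S ∪ {p})} = b S p q · e_{row S}` for `p ∉ S`: the arc `S → S ∪ {p}`.
[cite: LandsbergRessayre2017, §2.2] -/
theorem apply_A_single {S : Finset (Fin N)} {p : Fin N} (q : Fin N) {i₀ j : ι} (hp : p ∉ S)
    (hi₀ : row i₀ = S) (hj : col j = insert p S) :
    A p q (Pi.single j 1) = Pi.single i₀ (b S p q) := by
  funext i
  by_cases hpi : p ∈ row i
  · rw [hA0 p q _ i hpi]
    have : i ≠ i₀ := fun h => hp (by rw [← hi₀, ← h]; exact hpi)
    rw [Pi.single_eq_of_ne this]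
  · obtain ⟨j', hj'⟩ := hcol_ex _ (insert_ne_empty p (row i))
    rw [hAv p q _ i j' hpi hj']
    by_cases hi : i = i₀
    · subst hi
      have hjj : j' = j := hcol_inj (by rw [hj', hj, hi₀])
      rw [hjj, Pi.single_eq_same, Pi.single_eq_same, mul_one, hi₀]
    · have hjj : j' ≠ j := by
        intro h
        apply hi
        apply hrow_inj
        rw [hi₀]
        have e2 : (insert p (row i)).erase p = (insert p S).erase p := by rw [← hj', h, hj]
        rwa [erase_insert hpi, erase_insert hp] at e2
      rw [Pi.single_eq_of_ne hjj, mul_zero, Pi.single_eq_of_ne hi]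

variable [Fintype ι]

/-! ### Triangularity of an automorphism permuting the up-set subspaces -/

omit [DecidableEq ι] [Fintype ι] in
/-- **Triangularity.**  Let the coordinates of `K^ι` be labelled injectively by subsets `lab i`,
let `𝒰(S) = {v : v_i = 0 unless S ⊆ lab i}`, and let `g ∈ GL(K^ι)` satisfy `g 𝒰(S) = 𝒰(σ S)`
for all `S`.  Then the coefficient of `g e_i` at the coordinate `i'` with `lab i' = σ (lab i)` is
non-zero: otherwise `g e_i` would lie in the hyperplane `∑_{x ∉ lab i} 𝒰(σ (lab i ∪ {x}))`
`= g (∑_{x ∉ lab i} 𝒰(lab i ∪ {x}))` of `𝒰(σ lab i)`, which misses `e_i`. [folklore] -/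
theorem apply_single_ne_zero_of_map_eq [Fintype ι] [DecidableEq ι] {lab : ι → Finset (Fin N)}
    (hlab : Function.Injective lab) {U : Finset (Fin N) → Submodule K (ι → K)}
    (hU : ∀ (S : Finset (Fin N)) (v : ι → K), v ∈ U S ↔ ∀ i, ¬ S ⊆ lab i → v i = 0)
    (g : (ι → K) ≃ₗ[K] (ι → K)) {σ : Equiv.Perm (Fin N)}
    (hg : ∀ S : Finset (Fin N), (U S).map (g : (ι → K) →ₗ[K] (ι → K)) = U (S.map σ.toEmbedding))
    {i i' : ι} (hi' : lab i' = (lab i).map σ.toEmbedding) : g (Pi.single i 1) i' ≠ 0 := by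
  intro h0
  -- `g e_i ∈ 𝒰(σ lab i)`
  have hmem : g (Pi.single i 1) ∈ U ((lab i).map σ.toEmbedding) := by
    rw [← hg]
    refine Submodule.mem_map_of_mem ((hU _ _).2 fun i'' hi'' => ?_)
    exact Pi.single_eq_of_ne (fun h => hi'' (by rw [h])) _
  rw [hU] at hmem
  -- the hyperplane `P = ∑_{x ∉ lab i} 𝒰(lab i ∪ {x})` misses the coordinate `i`
  set P : Submodule K (ι → K) := ⨆ (x : Fin N) (_ : x ∉ lab i), U (insert x (lab i)) with hP
  have hPi : ∀ v ∈ P, v i = 0 := by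
    have hle : P ≤ LinearMap.ker (LinearMap.proj i : (ι → K) →ₗ[K] K) := by
      refine iSup₂_le fun x hx v hv => ?_
      rw [LinearMap.mem_ker, LinearMap.proj_apply]
      rw [hU] at hv
      exact hv i fun h => hx (h (mem_insert_self x _))
    intro v hv
    exact hle hv
  -- `g e_i ∈ g P`
  have hyP : g (Pi.single i 1) ∈ P.map (g : (ι → K) →ₗ[K] (ι → K)) := by
    simp only [hP, Submodule.map_iSup]
    rw [← Finset.univ_sum_single (g (Pi.single i 1))]
    refine Submodule.sum_mem _ fun i'' _ => ?_
    by_cases hy0 : g (Pi.single i 1) i'' = 0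
    · rw [hy0, Pi.single_zero]; exact Submodule.zero_mem _
    have hsub : (lab i).map σ.toEmbedding ⊆ lab i'' := by
      by_contra h
      exact hy0 (hmem i'' h)
    have hne : (lab i).map σ.toEmbedding ≠ lab i'' := by
      intro h
      apply hy0
      rw [hlab (h.symm.trans hi'.symm)]
      exact h0
    obtain ⟨x', hx'1, hx'2⟩ :=
      Finset.exists_of_ssubset (Finset.ssubset_iff_subset_ne.2 ⟨hsub, hne⟩)
    have hxi : σ.symm x' ∉ lab i := fun h => hx'2 (mem_map_equiv.2 h)
    refine Submodule.mem_iSup_of_mem (σ.symm x') (Submodule.mem_iSup_of_mem hxi ?_)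
    rw [hg, hU]
    intro i₃ hi₃
    refine Pi.single_eq_of_ne (fun h => hi₃ ?_) _
    rw [h, Finset.map_insert, Finset.insert_subset_iff]
    exact ⟨by simpa using hx'1, hsub⟩
  obtain ⟨w, hw, hgw⟩ := hyP
  have hwi : w = Pi.single i 1 := g.injective hgw
  have h1 := hPi w hw
  rw [hwi, Pi.single_eq_same] at h1
  exact one_ne_zero h1

/-! ### The orbit ratio -/

include hrow_inj hrow_ex hcol_inj hcol_ex hAv hA0 hUr hUc in
/-- **The orbit ratio.**  For an exact lift `(B, C)` of the row permutation `σ` permuting the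
up-set subspaces (`B 𝒰_row(S) = 𝒰_row(σ S)`, `C 𝒰_col(S) = 𝒰_col(σ S)`), reading
`B A_{kq} = A_{σ k, q} C` on `e_{col (S ∪ {k})}` at the row `σ S` gives
`b S k q · ξ = b (σ S) (σ k) q · η` with the non-zero diagonal coefficients `ξ = (B e_{row S})_{row σS}`,
`η = (C e_{col S ∪ {k}})_{col σ(S ∪ {k})}` of the triangular `B`, `C`; hence the arc forms of `(S, k)`
and `(σ S, σ k)` are proportional by a non-zero scalar independent of `q`. [cite: LandsbergRessayre2017, §6] -/
theorem orbit_ratio {σ : Equiv.Perm (Fin N)} (L : Lift Λ A σ fun _ => (1 : K))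
    (hB : ∀ S : Finset (Fin N),
      (Ur S).map (L.B : (ι → K) →ₗ[K] (ι → K)) = Ur (S.map σ.toEmbedding))
    (hC : ∀ S : Finset (Fin N),
      (Uc S).map (L.C : (ι → K) →ₗ[K] (ι → K)) = Uc (S.map σ.toEmbedding))
    {S : Finset (Fin N)} {k : Fin N} (hk : k ∉ S) :
    ∃ r : K, r ≠ 0 ∧ ∀ q, b (S.map σ.toEmbedding) (σ k) q = r * b S k q := by
  have hSu : S ≠ univ := fun h => hk (h ▸ mem_univ k)
  have hσk : σ k ∉ S.map σ.toEmbedding := by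
    rw [mem_map_equiv, Equiv.symm_apply_apply]; exact hk
  have hσSu : S.map σ.toEmbedding ≠ univ := fun h => hσk (h ▸ mem_univ _)
  obtain ⟨i₀, hi₀⟩ := hrow_ex S hSu
  obtain ⟨i₁, hi₁⟩ := hrow_ex _ hσSu
  obtain ⟨j₁, hj₁⟩ := hcol_ex (insert k S) (insert_ne_empty _ _)
  obtain ⟨j₂, hj₂⟩ := hcol_ex (insert (σ k) (S.map σ.toEmbedding)) (insert_ne_empty _ _)
  have hξ : L.B (Pi.single i₀ 1) i₁ ≠ 0 :=
    apply_single_ne_zero_of_map_eq hrow_inj hUr L.B hB (by rw [hi₁, hi₀])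
  have hη : L.C (Pi.single j₁ 1) j₂ ≠ 0 :=
    apply_single_ne_zero_of_map_eq hcol_inj hUc L.C hC
      (by rw [hj₂, hj₁, Finset.map_insert, Equiv.coe_toEmbedding])
  refine ⟨L.B (Pi.single i₀ 1) i₁ * (L.C (Pi.single j₁ 1) j₂)⁻¹,
    mul_ne_zero hξ (inv_ne_zero hη), fun q => ?_⟩
  have hcomm : L.B (A k q (Pi.single j₁ 1)) i₁ = A (σ k) q (L.C (Pi.single j₁ 1)) i₁ := by
    have h := L.comm_A k q (Pi.single j₁ 1)
    simp only [one_smul] at h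
    exact congrFun h i₁
  rw [apply_A_single hrow_inj hcol_inj hcol_ex hAv hA0 q hk hi₀ hj₁,
    hAv (σ k) q _ i₁ j₂ (by rw [hi₁]; exact hσk) (by rw [hj₂, hi₁]), hi₁] at hcomm
  have hl : L.B (Pi.single i₀ (b S k q)) i₁ = b S k q * L.B (Pi.single i₀ 1) i₁ := by
    have : (Pi.single i₀ (b S k q) : ι → K) = b S k q • (Pi.single i₀ 1 : ι → K) := by
      rw [← Pi.single_smul', smul_eq_mul, mul_one]
    rw [this, map_smul, Pi.smul_apply, smul_eq_mul]
  rw [hl] at hcomm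
  calc b (S.map σ.toEmbedding) (σ k) q
      = b (S.map σ.toEmbedding) (σ k) q * L.C (Pi.single j₁ 1) j₂ *
          (L.C (Pi.single j₁ 1) j₂)⁻¹ := by
        rw [mul_assoc, mul_inv_cancel₀ hη, mul_one]
    _ = b S k q * L.B (Pi.single i₀ 1) i₁ * (L.C (Pi.single j₁ 1) j₂)⁻¹ := by rw [← hcomm]
    _ = L.B (Pi.single i₀ 1) i₁ * (L.C (Pi.single j₁ 1) j₂)⁻¹ * b S k q := by ring

end Shape

/-! ### From orbit proportionality to a factorisation through the levels -/

/-- **Transitivity on arcs.**  If for every row permutation `σ` the arc forms of `(σ S, σ k)` and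
`(S, k)` (`k ∉ S`) are proportional, then `b S k q = ρ S k · α |S| q` for some `ρ`, `α`: the
symmetric group is transitive on the arcs of each level (map the reference arc `({0,…,ℓ-1}, ℓ)` to
`(S, k)` by a permutation sending the reference set to `S`, corrected by a transposition outside `S`).
[folklore] -/
theorem exists_factorisation_of_orbit {K : Type*} [Field K] {N : ℕ}
    {b : Finset (Fin N) → Fin N → Fin N → K}
    (horb : ∀ (σ : Equiv.Perm (Fin N)) (S : Finset (Fin N)) (k : Fin N), k ∉ S →
      ∃ r : K, ∀ q, b (S.map σ.toEmbedding) (σ k) q = r * b S k q) :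
    ∃ (ρ : Finset (Fin N) → Fin N → K) (α : ℕ → Fin N → K),
      ∀ (S : Finset (Fin N)) (k q : Fin N), k ∉ S → b S k q = ρ S k * α S.card q := by
  classical
  -- the reference arcs `(Iio ℓ, ℓ)`
  let α : ℕ → Fin N → K := fun ℓ q => if h : ℓ < N then b (Iio ⟨ℓ, h⟩) ⟨ℓ, h⟩ q else 0
  have key : ∀ (S : Finset (Fin N)) (k : Fin N), k ∉ S →
      ∃ r : K, ∀ q, b S k q = r * α S.card q := by
    intro S k hk
    have hℓ : S.card < N := by
      have h := (Finset.card_lt_iff_ne_univ S).2 (fun h => hk (h ▸ mem_univ k))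
      rwa [Fintype.card_fin] at h
    set k₀ : Fin N := ⟨S.card, hℓ⟩ with hk₀
    set S₀ : Finset (Fin N) := Iio k₀ with hS₀
    have hk₀S₀ : k₀ ∉ S₀ := by rw [hS₀, mem_Iio]; exact lt_irrefl _
    have hcard : S₀.card = S.card := by rw [hS₀, Fin.card_Iio]
    obtain ⟨σ₁, hσ₁⟩ := Equiv.Perm.exists_map_finset_eq S₀ S hcard
    have hk' : σ₁ k₀ ∉ S := by
      rw [← hσ₁, mem_map_equiv, Equiv.symm_apply_apply]
      exact hk₀S₀
    set τ : Equiv.Perm (Fin N) := Equiv.swap (σ₁ k₀) k with hτ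
    have hfix : ∀ x ∈ S, τ x = x := fun x hx =>
      Equiv.swap_apply_of_ne_of_ne (fun h => hk' (h ▸ hx)) (fun h => hk (h ▸ hx))
    have hSτ : S.map τ.toEmbedding = S := by
      ext x
      constructor
      · intro h
        obtain ⟨y, hy, rfl⟩ := Finset.mem_map.1 h
        show τ y ∈ S
        rw [hfix y hy]
        exact hy
      · intro hx
        exact Finset.mem_map.2 ⟨x, hx, hfix x hx⟩
    obtain ⟨r, hr⟩ := horb (τ * σ₁) S₀ k₀ hk₀S₀
    have hmap : S₀.map (τ * σ₁).toEmbedding = S := by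
      rw [Equiv.Perm.mul_def, Equiv.trans_toEmbedding, ← Finset.map_map, hσ₁, hSτ]
    have hkk : (τ * σ₁) k₀ = k := by
      rw [Equiv.Perm.mul_apply, hτ, Equiv.swap_apply_left]
    rw [hmap, hkk] at hr
    refine ⟨r, fun q => ?_⟩
    rw [hr q]
    simp only [α, dif_pos hℓ]
    rfl
  choose! ρ hρ using key
  exact ⟨ρ, α, fun S k q hk => hρ S k hk q⟩

/-! ### Canonical newness from a torus datum -/

/-- For a torus datum with `dim ker Λ = 1`, an injective member of the pencil and exact lifts of
all row permutations, EVERY canonical subspace `𝒫_S`, `S ≠ ∅`, is canonically new: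
`𝒫_S ⊄ ∑_{S' ⊊ S} 𝒫_{S'}` (LR17 §6: every non-empty `S` is full — `LRWeightCount.lean`).
[cite: LandsbergRessayre2017, §6] -/
theorem TorusData.not_canon_le_iSup_ssubsets {V : Type*} [AddCommGroup V] [Module ℂ V]
    [FiniteDimensional ℂ V] {m : ℕ} (D : TorusData m V)
    (hK : Module.finrank ℂ (LinearMap.ker D.Λ) = 1)
    (hgen : ∃ x : Fin m → Fin m → ℂ, Function.Injective (D.Λ + ∑ k, ∑ j, x k j • D.A k j))
    (hperm : ∀ σ : Equiv.Perm (Fin m), Nonempty (Lift D.Λ D.A σ fun _ => (1 : ℂ)))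
    {S : Finset (Fin m)} (hS : S ≠ ∅) :
    ¬ canon D.Λ D.A S ≤ ⨆ (S' : Finset (Fin m)) (_ : S' ⊂ S), canon D.Λ D.A S' := by
  have hK0 : LinearMap.ker D.Λ ≠ ⊥ := by
    intro h; rw [h, finrank_bot] at hK; exact zero_ne_one hK
  have hesc := not_canon_univ_le_range (A := D.A) hK0 hgen
  obtain ⟨βt, hβt⟩ := D.exists_top hK
  obtain ⟨ut, hut, hutne⟩ := D.exists_wt_of_not_le_range hesc
  have hwt : D.wt ut = βt := D.wt_eq_of_not_le_range hβt hutne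
  have hgood : D.Good ut := ⟨hut, fun h => hutne (by rw [h]; exact bot_le)⟩
  have hsupp : supp ut = univ := D.supp_eq_univ_of_escape hβt hwt hut.1 hesc hperm
  exact D.not_le_iSup_of_full (D.full_of_ne_empty hgood hsupp hperm hS)

/-! ### Conclusion for matrices -/

/-- **Level forms of a left-equivariant Grenet-shaped pencil are proportional** (symmetry half of
the equality case of LR17 Thm. 2.8).  Let `Λm = ε · [row i = col j]` and
`Am p q = (b (row i) p q · [p ∉ row i, col j = row i ∪ {p}])_{ij}` be a Grenet-shaped pencil over
`ℂ` (rows labelled bijectively by the subsets `≠ univ`, columns by the subsets `≠ ∅`, `ε ≠ 0`),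
and suppose it carries a torus datum with `dim ker Λ = 1`, an injective member and an exact lift of
every row permutation (as every left-monomially-equivariant representation of `per_N` does).  Then
the arc coefficients factor through the levels: `b S k q = ρ S k · α |S| q` for `k ∉ S`.
Proof: canonical newness (`not_canon_le_iSup_ssubsets`) ⟹ `𝒫_{S'} = 𝒰_row(S'ᶜ)`
(`canon_eq_Ur_compl`) ⟹ the permutation lifts permute the up-set subspaces (`map_Ur_eq`,
`map_Uc_eq`) ⟹ orbit ratios (`orbit_ratio`) ⟹ factorisation (`exists_factorisation_of_orbit`).
[cite: LandsbergRessayre2017, Thm. 2.8] -/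
theorem exists_level_factorisation {N : ℕ} {ι : Type*} [Fintype ι] [DecidableEq ι]
    {row col : ι → Finset (Fin N)}
    (hrow_inj : Function.Injective row) (hrow_ne : ∀ i, row i ≠ univ)
    (hrow_ex : ∀ S, S ≠ univ → ∃ i, row i = S)
    (hcol_inj : Function.Injective col) (hcol_ne : ∀ j, col j ≠ ∅)
    (hcol_ex : ∀ T, T ≠ ∅ → ∃ j, col j = T)
    {ε : ℂ} (hε : ε ≠ 0) {b : Finset (Fin N) → Fin N → Fin N → ℂ}
    {Λm : Matrix ι ι ℂ} (hΛ : ∀ i j, Λm i j = if row i = col j then ε else 0)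
    {Am : Fin N → Fin N → Matrix ι ι ℂ}
    (hA : ∀ p q i j,
      Am p q i j = if p ∉ row i ∧ col j = insert p (row i) then b (row i) p q else 0)
    (D : TorusData N (ι → ℂ)) (hDΛ : D.Λ = Matrix.toLin' Λm)
    (hDA : D.A = fun p q => Matrix.toLin' (Am p q))
    (hK : Module.finrank ℂ (LinearMap.ker D.Λ) = 1)
    (hgen : ∃ x : Fin N → Fin N → ℂ, Function.Injective (D.Λ + ∑ k, ∑ j, x k j • D.A k j))
    (hperm : ∀ σ : Equiv.Perm (Fin N), Nonempty (Lift D.Λ D.A σ fun _ => (1 : ℂ))) :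
    ∃ (ρ : Finset (Fin N) → Fin N → ℂ) (α : ℕ → Fin N → ℂ),
      ∀ (S : Finset (Fin N)) (k q : Fin N), k ∉ S → b S k q = ρ S k * α S.card q := by
  classical
  -- the action of the pencil on coordinate vectors
  have hΛv : ∀ (v : ι → ℂ) (i j : ι), col j = row i → D.Λ v i = ε * v j := by
    intro v i j hj
    rw [hDΛ, Matrix.toLin'_apply, Matrix.mulVec, dotProduct, Finset.sum_eq_single j]
    · rw [hΛ, if_pos hj.symm]
    · intro j' _ hj'
      rw [hΛ, if_neg (fun h => hj' (hcol_inj (h.symm.trans hj.symm))), zero_mul]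
    · exact fun h => absurd (mem_univ j) h
  have hΛ0 : ∀ (v : ι → ℂ) (i : ι), row i = ∅ → D.Λ v i = 0 := by
    intro v i hi
    rw [hDΛ, Matrix.toLin'_apply, Matrix.mulVec, dotProduct]
    refine Finset.sum_eq_zero fun j _ => ?_
    rw [hΛ, if_neg (fun h => hcol_ne j (h.symm.trans hi)), zero_mul]
  have hAv : ∀ (p q : Fin N) (w : ι → ℂ) (i j : ι), p ∉ row i → col j = insert p (row i) →
      D.A p q w i = b (row i) p q * w j := by
    intro p q w i j hpi hj
    rw [hDA]
    dsimp only
    rw [Matrix.toLin'_apply, Matrix.mulVec, dotProduct, Finset.sum_eq_single j]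
    · rw [hA, if_pos ⟨hpi, hj⟩]
    · intro j' _ hj'
      rw [hA, if_neg (fun h => hj' (hcol_inj (h.2.trans hj.symm))), zero_mul]
    · exact fun h => absurd (mem_univ j) h
  have hA0 : ∀ (p q : Fin N) (w : ι → ℂ) (i : ι), p ∈ row i → D.A p q w i = 0 := by
    intro p q w i hpi
    rw [hDA]
    dsimp only
    rw [Matrix.toLin'_apply, Matrix.mulVec, dotProduct]
    refine Finset.sum_eq_zero fun j _ => ?_
    rw [hA, if_neg (fun h => h.1 hpi), zero_mul]
  -- the up-set coordinate subspaces
  set Ur : Finset (Fin N) → Submodule ℂ (ι → ℂ) :=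
    fun S => Submodule.pi {i | ¬ S ⊆ row i} fun _ => ⊥ with hUrdef
  set Uc : Finset (Fin N) → Submodule ℂ (ι → ℂ) :=
    fun S => Submodule.pi {j | ¬ S ⊆ col j} fun _ => ⊥ with hUcdef
  have hUr : ∀ (S : Finset (Fin N)) (v : ι → ℂ), v ∈ Ur S ↔ ∀ i, ¬ S ⊆ row i → v i = 0 := by
    intro S v
    simp only [hUrdef, Submodule.mem_pi, Set.mem_setOf_eq, Submodule.mem_bot]
  have hUc : ∀ (S : Finset (Fin N)) (w : ι → ℂ), w ∈ Uc S ↔ ∀ j, ¬ S ⊆ col j → w j = 0 := by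
    intro S w
    simp only [hUcdef, Submodule.mem_pi, Set.mem_setOf_eq, Submodule.mem_bot]
  -- canonical newness, the canonical subspaces, and the orbit ratios
  have hnew : ∀ S' : Finset (Fin N), S' ≠ ∅ →
      ¬ canon D.Λ D.A S' ≤ ⨆ (R : Finset (Fin N)) (_ : R ⊂ S'), canon D.Λ D.A R :=
    fun S' hS' => D.not_canon_le_iSup_ssubsets hK hgen hperm hS'
  have hcanon : ∀ S' : Finset (Fin N), canon D.Λ D.A S' = Ur S'ᶜ :=
    canon_eq_Ur_compl hrow_inj hrow_ne hrow_ex hcol_ex hε hΛv hΛ0 hAv hA0 hUr hUc hnew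
  have hcomap : ∀ S : Finset (Fin N), (Ur S).comap D.Λ = Uc S :=
    comap_Ur_eq_Uc hrow_ex hcol_ex hε hΛv hΛ0 hUr hUc
  refine exists_factorisation_of_orbit fun σ S k hk => ?_
  obtain ⟨L⟩ := hperm σ
  have hB := map_Ur_eq hcanon L
  have hC := map_Uc_eq hcomap L hB
  obtain ⟨r, -, hr⟩ := orbit_ratio hrow_inj hrow_ex hcol_inj hcol_ex hAv hA0 hUr hUc L hB hC hk
  exact ⟨r, hr⟩

end LRPencil

end Literature.Computability.AlgebraicComplexity
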